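import Summits.AtomisticToContinuum.BoseEinsteinCondensation.Theorems.BECCellInformationTwoScaleReduction
import Summits.AtomisticToContinuum.BoseEinsteinCondensation.Theorems.BECCellInformationCoarseChainRule

/-!
# Crux `OneBodyEntropyBound` (stmt-AtomisticToContinuum-13440), line `registered`:
# helpers for the stub `stub_withinCellFisherLSI` — regularity of the one-body marginal

Support file (`--supports stmt-AtomisticToContinuum-13440`, registered helper stub
`stub_withinCellFisherBound`) for the stub `stub_withinCellFisherLSI` of the birth skeleton of the
crux `OneBodyEntropyBound` (route `BECCellInformation`), proved in
`BECCellInformationOneBodyEntropyBoundWithinCellFisherLSI.lean`. For a Dirichlet trial state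
`Ψ ∈ TrialState (n+1) L` and its one-body marginal `P(x) = ∫ |Ψ(x :: Y)|² dY`:

* `Ψ`, `|Ψ|²` have compact support (closed box `[0,L]^{3(n+1)}`), so `D|Ψ|²` is bounded; the slice
  derivative `D_x |Ψ(x :: Y)|² = D|Ψ|²(x :: Y) ∘ (v ↦ (v, 0, …, 0))` is jointly continuous,
  uniformly bounded, and equals `2 Re⟨Ψ, DΨ[(v,0,…,0)]⟩(x :: Y)` on `v`;
* **differentiation under the integral sign** (`hasFDerivAt_integral_of_dominated_of_fderiv_le`
  over the compact closed box of bath configurations): `P` is `C¹`, `DP(x) = ∫ D_x|Ψ(x :: Y)|² dY`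
  (`contDiff_marginal`; continuity by `continuous_parametric_integral_of_continuous`);
* **convexity of the Fisher information** (Cauchy–Schwarz in `L²(dY)` via the discriminant):
  `(∂_i P)² ≤ 4 P · F_i`, `F_i(x) = ∫ |∂_{x,i}Ψ(x :: Y)|² dY`; hence for `ε > 0` the regularised
  root `G_ε = √(P + ε)` is `C¹` with `Σ_i (∂_i G_ε)² ≤ Σ_i F_i ≤ ∫ |∇₀Ψ|²(x :: Y) dY`
  (`fisher_bound` = the registered helper stub `stub_withinCellFisherBound`), the gradient input
  of the cube log-Sobolev inequality in the main file.

Standard real analysis ([Lieb–Loss, *Analysis*, Thm. 7.8]-type folklore for the Fisher bound).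
-/

noncomputable section

namespace Summit.AtomisticToContinuum.BoseEinsteinCondensation.Cruxes.OneBodyEntropyBound.Birth

namespace WithinCell

open MeasureTheory Set Filter Topology InformationTheory
open scoped ENNReal NNReal
open Literature.MathematicalPhysics.QuantumManyBody.BoseGas
open Summit.AtomisticToContinuum.BoseEinsteinCondensation.Theorems

variable {n : ℕ} {L : ℝ}

/-! ### Compact support and global bounds -/

/-- The closed coordinate box `[0,L]^{3m}` of `m`-particle configurations is compact. [folklore] -/
theorem isCompact_closedBox (m : ℕ) (L : ℝ) :
    IsCompact {X : Config m | ∀ i j, X i j ∈ Icc (0 : ℝ) L} := by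
  have h : {X : Config m | ∀ i j, X i j ∈ Icc (0 : ℝ) L} =
      Set.pi Set.univ (fun _ : Fin m => {y : Space | ∀ j, y j ∈ Icc (0 : ℝ) L}) := by
    ext X; simp
  rw [h]
  exact isCompact_univ_pi fun _ => TwoScaleReduction.isCompact_IccCell (fun _ => 0) (fun _ => L)

/-- A trial state has compact support (the closed box `[0,L]^{3(n+1)}`). [folklore] -/
theorem hasCompactSupport_psi (Ψ : TrialState (n + 1) L) : HasCompactSupport Ψ.ψ :=
  HasCompactSupport.intro (isCompact_closedBox (n + 1) L) fun X hX =>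
    Ψ.eq_zero X fun h => hX fun i j => Ioo_subset_Icc_self (h i j)

/-- `|Ψ|²` is `C¹`. [folklore] -/
theorem contDiff_normSq (Ψ : TrialState (n + 1) L) : ContDiff ℝ 1 fun X => ‖Ψ.ψ X‖ ^ 2 :=
  Ψ.contDiff.norm_sq (𝕜 := ℝ)

/-- `|Ψ|²` has compact support. [folklore] -/
theorem hasCompactSupport_normSq (Ψ : TrialState (n + 1) L) :
    HasCompactSupport fun X => ‖Ψ.ψ X‖ ^ 2 :=
  (hasCompactSupport_psi Ψ).norm.comp_left (g := fun t : ℝ => t ^ 2) (by simp)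

/-- The derivative of `|Ψ|²` is bounded. [folklore] -/
theorem exists_bound_fderiv_normSq (Ψ : TrialState (n + 1) L) :
    ∃ C, ∀ X, ‖fderiv ℝ (fun X => ‖Ψ.ψ X‖ ^ 2) X‖ ≤ C :=
  ((contDiff_normSq Ψ).continuous_fderiv one_ne_zero).bounded_above_of_compact_support
    ((hasCompactSupport_normSq Ψ).fderiv (𝕜 := ℝ))

/-- `x ↦ x :: Y` has derivative `v ↦ (v, 0, …, 0)`. [folklore] -/
theorem hasFDerivAt_vecCons (Y : Config n) (x : Space) :
    HasFDerivAt (fun y : Space => (Matrix.vecCons y Y : Config (n + 1)))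
      (ContinuousLinearMap.pi (Pi.single (0 : Fin (n + 1)) (ContinuousLinearMap.id ℝ Space)))
      x := by
  have hfun : (fun y : Space => (Matrix.vecCons y Y : Config (n + 1))) =
      Function.update (Matrix.vecCons (0 : Space) Y : Config (n + 1)) 0 :=
    funext fun y => (update_vecCons_zero 0 y Y).symm
  rw [hfun]
  exact hasFDerivAt_update (𝕜 := ℝ) (Matrix.vecCons (0 : Space) Y : Config (n + 1)) x

/-- `(v ↦ (v, 0, …, 0)) v = Pi.single 0 v`. [folklore] -/
theorem pi_single_id_apply (v : Space) :
    (ContinuousLinearMap.pi (Pi.single (0 : Fin (n + 1)) (ContinuousLinearMap.id ℝ Space)) :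
      Space →L[ℝ] Config (n + 1)) v = Pi.single (0 : Fin (n + 1)) v := by
  funext j
  by_cases hj : j = 0
  · subst hj; simp
  · simp [hj]

/-- The slice `x ↦ |Ψ(x :: Y)|²` is differentiable. [folklore] -/
theorem differentiable_normSq_vecCons (Ψ : TrialState (n + 1) L) (Y : Config n) :
    Differentiable ℝ fun y : Space => ‖Ψ.ψ (Matrix.vecCons y Y)‖ ^ 2 :=
  ((contDiff_vecCons_slice Ψ.contDiff Y).norm_sq (𝕜 := ℝ)).differentiable_one

/-- **Chain rule for the slice**: `D_x |Ψ(x :: Y)|² = D|Ψ|²(x :: Y) ∘ (v ↦ (v, 0, …, 0))`.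
[folklore] -/
theorem fderiv_normSq_vecCons (Ψ : TrialState (n + 1) L) (x : Space) (Y : Config n) :
    fderiv ℝ (fun y : Space => ‖Ψ.ψ (Matrix.vecCons y Y)‖ ^ 2) x =
      (fderiv ℝ (fun X => ‖Ψ.ψ X‖ ^ 2) (Matrix.vecCons x Y)).comp
        (ContinuousLinearMap.pi (Pi.single (0 : Fin (n + 1)) (ContinuousLinearMap.id ℝ Space))) :=
  ((((contDiff_normSq Ψ).differentiable_one _).hasFDerivAt.comp x
    (hasFDerivAt_vecCons Y x)).fderiv :)

/-- `(x, Y) ↦ D_x |Ψ(x :: Y)|²` is continuous. [folklore] -/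
theorem continuous_fderiv_normSq_vecCons (Ψ : TrialState (n + 1) L) :
    Continuous fun p : Space × Config n =>
      fderiv ℝ (fun y : Space => ‖Ψ.ψ (Matrix.vecCons y p.2)‖ ^ 2) p.1 := by
  simp only [fderiv_normSq_vecCons]
  exact (((contDiff_normSq Ψ).continuous_fderiv one_ne_zero).comp
    (continuous_fst.matrixVecCons continuous_snd)).clm_comp continuous_const

/-- `D_x |Ψ(x :: Y)|²` is bounded uniformly in `(x, Y)`. [folklore] -/
theorem exists_bound_fderiv_normSq_vecCons (Ψ : TrialState (n + 1) L) :
    ∃ C, ∀ x Y, ‖fderiv ℝ (fun y : Space => ‖Ψ.ψ (Matrix.vecCons y Y)‖ ^ 2) x‖ ≤ C := by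
  obtain ⟨C, hC⟩ := exists_bound_fderiv_normSq Ψ
  refine ⟨C * ‖(ContinuousLinearMap.pi (Pi.single (0 : Fin (n + 1))
    (ContinuousLinearMap.id ℝ Space)) : Space →L[ℝ] Config (n + 1))‖, fun x Y => ?_⟩
  rw [fderiv_normSq_vecCons]
  exact (ContinuousLinearMap.opNorm_comp_le _ _).trans
    (mul_le_mul_of_nonneg_right (hC _) (norm_nonneg _))

/-- `D_x |Ψ(x :: Y)|² [v] = 2 Re ⟨Ψ(x :: Y), DΨ(x :: Y)[(v, 0, …, 0)]⟩`. [folklore] -/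
theorem fderiv_normSq_vecCons_apply (Ψ : TrialState (n + 1) L) (x : Space) (Y : Config n)
    (v : Space) :
    fderiv ℝ (fun y : Space => ‖Ψ.ψ (Matrix.vecCons y Y)‖ ^ 2) x v =
      2 * inner ℝ (Ψ.ψ (Matrix.vecCons x Y))
        (fderiv ℝ Ψ.ψ (Matrix.vecCons x Y) (Pi.single 0 v)) := by
  have h := (Ψ.contDiff.differentiable_one (Matrix.vecCons x Y)).hasFDerivAt.norm_sq
  rw [fderiv_normSq_vecCons, h.fderiv, ContinuousLinearMap.comp_apply, pi_single_id_apply,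
    FunLike.coe_smul, Pi.smul_apply, ContinuousLinearMap.comp_apply, innerSL_apply_apply,
    two_nsmul, two_mul]

/-- `|D_x |Ψ(x :: Y)|² [v]| ≤ 2 |Ψ(x :: Y)| · |DΨ(x :: Y)[(v, 0, …, 0)]|`. [folklore] -/
theorem abs_fderiv_normSq_vecCons_le (Ψ : TrialState (n + 1) L) (x : Space) (Y : Config n)
    (v : Space) :
    |fderiv ℝ (fun y : Space => ‖Ψ.ψ (Matrix.vecCons y Y)‖ ^ 2) x v| ≤
      2 * (‖Ψ.ψ (Matrix.vecCons x Y)‖ * ‖fderiv ℝ Ψ.ψ (Matrix.vecCons x Y) (Pi.single 0 v)‖) := by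
  rw [fderiv_normSq_vecCons_apply, abs_mul, abs_two]
  exact mul_le_mul_of_nonneg_left (abs_real_inner_le_norm _ _) zero_le_two

/-- `Y ↦ DΨ(x :: Y)[V]` is continuous. [folklore] -/
theorem continuous_fderiv_vecCons_apply (Ψ : TrialState (n + 1) L) (x : Space)
    (V : Config (n + 1)) : Continuous fun Y : Config n => fderiv ℝ Ψ.ψ (Matrix.vecCons x Y) V :=
  ((Ψ.contDiff.continuous_fderiv one_ne_zero).comp
    (continuous_const.matrixVecCons continuous_id)).clm_apply continuous_const

/-! ### The one-body marginal `P(x) = ∫ |Ψ(x :: Y)|² dY` is `C¹` -/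

/-- `|Ψ(x :: Y)|² = 0` for bath configurations `Y` off the closed box. [folklore] -/
theorem normSq_vecCons_eq_zero_of_not_mem (Ψ : TrialState (n + 1) L) (x : Space) {Y : Config n}
    (hY : Y ∉ {X : Config n | ∀ i j, X i j ∈ Icc (0 : ℝ) L}) :
    ‖Ψ.ψ (Matrix.vecCons x Y)‖ ^ 2 = 0 := by
  rw [Ψ.eq_zero _ fun hX => hY fun i j => Ioo_subset_Icc_self (by simpa using hX i.succ j)]
  simp

/-- The marginal as an integral over the compact closed box of bath configurations. [folklore] -/
theorem marginal_eq_setIntegral (Ψ : TrialState (n + 1) L) (x : Space) :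
    ∫ Y : Config n, ‖Ψ.ψ (Matrix.vecCons x Y)‖ ^ 2 =
      ∫ Y in {X : Config n | ∀ i j, X i j ∈ Icc (0 : ℝ) L}, ‖Ψ.ψ (Matrix.vecCons x Y)‖ ^ 2 :=
  (setIntegral_eq_integral_of_forall_compl_eq_zero fun _ hY =>
    normSq_vecCons_eq_zero_of_not_mem Ψ x hY).symm

/-- `(x, Y) ↦ |Ψ(x :: Y)|²` is continuous. [folklore] -/
theorem continuous_normSq_vecCons (Ψ : TrialState (n + 1) L) :
    Continuous fun p : Space × Config n => ‖Ψ.ψ (Matrix.vecCons p.1 p.2)‖ ^ 2 :=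
  ((Ψ.contDiff.continuous.comp (continuous_fst.matrixVecCons continuous_snd)).norm).pow 2

/-- **Differentiation under the integral sign**: the marginal is differentiable with
`DP(x) = ∫ D_x|Ψ(x :: Y)|² dY` (integral over the compact closed box of bath configurations, where
the integrand lives). [folklore] -/
theorem hasFDerivAt_marginal (Ψ : TrialState (n + 1) L) (x₀ : Space) :
    HasFDerivAt (fun x => ∫ Y : Config n, ‖Ψ.ψ (Matrix.vecCons x Y)‖ ^ 2)
      (∫ Y in {X : Config n | ∀ i j, X i j ∈ Icc (0 : ℝ) L},
        fderiv ℝ (fun y : Space => ‖Ψ.ψ (Matrix.vecCons y Y)‖ ^ 2) x₀) x₀ := by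
  have hK := isCompact_closedBox n L
  obtain ⟨C, hC⟩ := exists_bound_fderiv_normSq_vecCons Ψ
  have hcont := continuous_normSq_vecCons Ψ
  have h := hasFDerivAt_integral_of_dominated_of_fderiv_le
    (μ := volume.restrict {X : Config n | ∀ i j, X i j ∈ Icc (0 : ℝ) L})
    (F := fun (x : Space) (Y : Config n) => ‖Ψ.ψ (Matrix.vecCons x Y)‖ ^ 2)
    (F' := fun x Y => fderiv ℝ (fun y : Space => ‖Ψ.ψ (Matrix.vecCons y Y)‖ ^ 2) x) (x₀ := x₀)
    (bound := fun _ => C) univ_mem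
    (Eventually.of_forall fun x =>
      (hcont.comp (Continuous.prodMk_right x)).aestronglyMeasurable)
    ((hcont.comp (Continuous.prodMk_right x₀)).continuousOn.integrableOn_compact hK)
    ((continuous_fderiv_normSq_vecCons Ψ).comp (Continuous.prodMk_right x₀)).aestronglyMeasurable
    (ae_of_all _ fun Y x _ => hC x Y)
    (integrableOn_const hK.measure_lt_top.ne)
    (ae_of_all _ fun Y x _ => (differentiable_normSq_vecCons Ψ Y x).hasFDerivAt)
  have hfun : (fun x => ∫ Y : Config n, ‖Ψ.ψ (Matrix.vecCons x Y)‖ ^ 2) = fun x =>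
      ∫ Y in {X : Config n | ∀ i j, X i j ∈ Icc (0 : ℝ) L}, ‖Ψ.ψ (Matrix.vecCons x Y)‖ ^ 2 :=
    funext fun x => marginal_eq_setIntegral Ψ x
  rw [hfun]
  exact h

/-- The marginal is continuous. [folklore] -/
theorem continuous_marginal (Ψ : TrialState (n + 1) L) :
    Continuous fun x => ∫ Y : Config n, ‖Ψ.ψ (Matrix.vecCons x Y)‖ ^ 2 := by
  have hfun : (fun x => ∫ Y : Config n, ‖Ψ.ψ (Matrix.vecCons x Y)‖ ^ 2) = fun x =>
      ∫ Y in {X : Config n | ∀ i j, X i j ∈ Icc (0 : ℝ) L}, ‖Ψ.ψ (Matrix.vecCons x Y)‖ ^ 2 :=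
    funext fun x => marginal_eq_setIntegral Ψ x
  rw [hfun]
  exact continuous_parametric_integral_of_continuous (continuous_normSq_vecCons Ψ)
    (isCompact_closedBox n L)

/-- **The marginal is `C¹`** (its derivative `x ↦ ∫ D_x|Ψ(x :: Y)|² dY` is a parametric integral
of a continuous integrand over a compact set). [folklore] -/
theorem contDiff_marginal (Ψ : TrialState (n + 1) L) :
    ContDiff ℝ 1 fun x => ∫ Y : Config n, ‖Ψ.ψ (Matrix.vecCons x Y)‖ ^ 2 := by
  have hd : fderiv ℝ (fun x => ∫ Y : Config n, ‖Ψ.ψ (Matrix.vecCons x Y)‖ ^ 2) =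
      fun x : Space => ∫ Y in {X : Config n | ∀ i j, X i j ∈ Icc (0 : ℝ) L},
        fderiv ℝ (fun y : Space => ‖Ψ.ψ (Matrix.vecCons y Y)‖ ^ 2) x :=
    funext fun x => (hasFDerivAt_marginal Ψ x).fderiv
  refine contDiff_one_iff_fderiv.2 ⟨fun x => (hasFDerivAt_marginal Ψ x).differentiableAt, ?_⟩
  rw [hd]
  exact continuous_parametric_integral_of_continuous (continuous_fderiv_normSq_vecCons Ψ)
    (isCompact_closedBox n L)

/-- The marginal is non-negative. [folklore] -/
theorem marginal_nonneg (Ψ : TrialState (n + 1) L) (x : Space) :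
    0 ≤ ∫ Y : Config n, ‖Ψ.ψ (Matrix.vecCons x Y)‖ ^ 2 :=
  integral_nonneg fun _ => sq_nonneg _

/-- **Cauchy–Schwarz** for continuous functions on a compact set: `(∫_K a b)² ≤ ∫_K a² · ∫_K b²`
(via the discriminant of `t ↦ ∫_K (t a + b)² ≥ 0`). [folklore] -/
theorem sq_setIntegral_mul_le {α : Type*} [TopologicalSpace α] [T2Space α] [MeasurableSpace α]
    [OpensMeasurableSpace α] {μ : Measure α} [IsFiniteMeasureOnCompacts μ] {K : Set α}
    (hK : IsCompact K) {a b : α → ℝ} (ha : Continuous a) (hb : Continuous b) :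
    (∫ y in K, a y * b y ∂μ) ^ 2 ≤ (∫ y in K, a y ^ 2 ∂μ) * ∫ y in K, b y ^ 2 ∂μ := by
  have hi : ∀ {f : α → ℝ}, Continuous f → Integrable f (μ.restrict K) := fun hf =>
    hf.continuousOn.integrableOn_compact hK
  have hq : ∀ t : ℝ, 0 ≤ (∫ y in K, a y ^ 2 ∂μ) * (t * t) + (2 * ∫ y in K, a y * b y ∂μ) * t +
      ∫ y in K, b y ^ 2 ∂μ := by
    intro t
    have h := integral_nonneg (μ := μ.restrict K) (f := fun y => (t * a y + b y) ^ 2)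
      fun y => sq_nonneg _
    have e : (fun y => (t * a y + b y) ^ 2) =
        fun y => (t * t) * a y ^ 2 + (2 * t) * (a y * b y) + b y ^ 2 := by
      funext y; ring
    have i1 : Integrable (fun y => (t * t) * a y ^ 2) (μ.restrict K) :=
      hi (continuous_const.mul (ha.pow 2))
    have i2 : Integrable (fun y => (2 * t) * (a y * b y)) (μ.restrict K) :=
      hi (continuous_const.mul (ha.mul hb))
    have i3 : Integrable (fun y => b y ^ 2) (μ.restrict K) := hi (hb.pow 2)
    have i12 : Integrable (fun y => (t * t) * a y ^ 2 + (2 * t) * (a y * b y)) (μ.restrict K) :=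
      i1.add i2
    rw [e, integral_add i12 i3, integral_add i1 i2, integral_const_mul, integral_const_mul] at h
    linarith
  have hd := discrim_le_zero hq
  rw [discrim] at hd
  nlinarith [hd]

/-- **Convexity of the Fisher information (pointwise Cauchy–Schwarz in `L²(dY)`)**:
`(∂_i P)² ≤ 4 P · F_i` with `F_i(x) = ∫ |∂_{x,i}Ψ(x :: Y)|² dY`. [folklore] -/
theorem sq_marginalDeriv_le (Ψ : TrialState (n + 1) L) (x : Space) (i : Fin 3) :
    ((∫ Y in {X : Config n | ∀ i j, X i j ∈ Icc (0 : ℝ) L},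
        fderiv ℝ (fun y : Space => ‖Ψ.ψ (Matrix.vecCons y Y)‖ ^ 2) x)
        (EuclideanSpace.single i 1)) ^ 2 ≤
      4 * (∫ Y : Config n, ‖Ψ.ψ (Matrix.vecCons x Y)‖ ^ 2) *
        ∫ Y in {X : Config n | ∀ i j, X i j ∈ Icc (0 : ℝ) L},
          ‖fderiv ℝ Ψ.ψ (Matrix.vecCons x Y)
            (Pi.single 0 (EuclideanSpace.single i (1 : ℝ)))‖ ^ 2 := by
  set K := {X : Config n | ∀ i j, X i j ∈ Icc (0 : ℝ) L} with hKdef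
  set v : Space := EuclideanSpace.single i 1 with hv
  set a : Config n → ℝ := fun Y => ‖Ψ.ψ (Matrix.vecCons x Y)‖ with ha_def
  set b : Config n → ℝ := fun Y => ‖fderiv ℝ Ψ.ψ (Matrix.vecCons x Y) (Pi.single 0 v)‖
    with hb_def
  have hK : IsCompact K := isCompact_closedBox n L
  have ha : Continuous a :=
    (Ψ.contDiff.continuous.comp (continuous_const.matrixVecCons continuous_id)).norm
  have hb : Continuous b := (continuous_fderiv_vecCons_apply Ψ x _).norm
  have hint : IntegrableOn
      (fun Y => fderiv ℝ (fun y : Space => ‖Ψ.ψ (Matrix.vecCons y Y)‖ ^ 2) x) K :=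
    ((continuous_fderiv_normSq_vecCons Ψ).comp
      (Continuous.prodMk_right x)).continuousOn.integrableOn_compact hK
  have h1 : (∫ Y in K, fderiv ℝ (fun y : Space => ‖Ψ.ψ (Matrix.vecCons y Y)‖ ^ 2) x) v =
      ∫ Y in K, fderiv ℝ (fun y : Space => ‖Ψ.ψ (Matrix.vecCons y Y)‖ ^ 2) x v :=
    ContinuousLinearMap.integral_apply hint v
  have h2 : |(∫ Y in K, fderiv ℝ (fun y : Space => ‖Ψ.ψ (Matrix.vecCons y Y)‖ ^ 2) x) v| ≤
      2 * ∫ Y in K, a Y * b Y := by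
    rw [h1, ← integral_const_mul, ← Real.norm_eq_abs]
    refine norm_integral_le_of_norm_le
      ((continuous_const.mul (ha.mul hb)).continuousOn.integrableOn_compact hK)
      (ae_of_all _ fun Y => ?_)
    rw [Real.norm_eq_abs]
    exact abs_fderiv_normSq_vecCons_le Ψ x Y v
  have h3 := sq_setIntegral_mul_le (μ := volume) hK ha hb
  have hP : ∫ Y : Config n, ‖Ψ.ψ (Matrix.vecCons x Y)‖ ^ 2 = ∫ Y in K, a Y ^ 2 :=
    marginal_eq_setIntegral Ψ x
  rw [hP]
  calc ((∫ Y in K, fderiv ℝ (fun y : Space => ‖Ψ.ψ (Matrix.vecCons y Y)‖ ^ 2) x) v) ^ 2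
      = |(∫ Y in K, fderiv ℝ (fun y : Space => ‖Ψ.ψ (Matrix.vecCons y Y)‖ ^ 2) x) v| ^ 2 :=
        (sq_abs _).symm
    _ ≤ (2 * ∫ Y in K, a Y * b Y) ^ 2 := pow_le_pow_left₀ (abs_nonneg _) h2 2
    _ = 4 * (∫ Y in K, a Y * b Y) ^ 2 := by ring
    _ ≤ 4 * ((∫ Y in K, a Y ^ 2) * ∫ Y in K, b Y ^ 2) :=
        mul_le_mul_of_nonneg_left h3 (by norm_num)
    _ = _ := by ring

/-- `Σ_i F_i(x) ≤ ∫ |∇₀Ψ|²(x :: Y) dY` in `[0, ∞]`. [folklore] -/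
theorem ofReal_sum_fibreGradSq_le (Ψ : TrialState (n + 1) L) (x : Space) :
    ENNReal.ofReal (∑ i, ∫ Y in {X : Config n | ∀ i j, X i j ∈ Icc (0 : ℝ) L},
        ‖fderiv ℝ Ψ.ψ (Matrix.vecCons x Y) (Pi.single 0 (EuclideanSpace.single i (1 : ℝ)))‖ ^ 2) ≤
      ∫⁻ Y, partialGradSq 0 Ψ.ψ (Matrix.vecCons x Y) := by
  have hK := isCompact_closedBox n L
  have hb : ∀ i : Fin 3, Continuous fun Y : Config n => ‖fderiv ℝ Ψ.ψ (Matrix.vecCons x Y)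
      (Pi.single 0 (EuclideanSpace.single i (1 : ℝ)))‖ ^ 2 :=
    fun i => (continuous_fderiv_vecCons_apply Ψ x _).norm.pow 2
  rw [ENNReal.ofReal_sum_of_nonneg fun i _ => setIntegral_nonneg hK.measurableSet
    fun _ _ => sq_nonneg _]
  calc ∑ i, ENNReal.ofReal (∫ Y in {X : Config n | ∀ i j, X i j ∈ Icc (0 : ℝ) L},
          ‖fderiv ℝ Ψ.ψ (Matrix.vecCons x Y) (Pi.single 0 (EuclideanSpace.single i (1 : ℝ)))‖ ^ 2)
      = ∑ i, ∫⁻ Y in {X : Config n | ∀ i j, X i j ∈ Icc (0 : ℝ) L}, ENNReal.ofReal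
          (‖fderiv ℝ Ψ.ψ (Matrix.vecCons x Y)
            (Pi.single 0 (EuclideanSpace.single i (1 : ℝ)))‖ ^ 2) :=
        Finset.sum_congr rfl fun i _ => ofReal_integral_eq_lintegral_ofReal
          ((hb i).continuousOn.integrableOn_compact hK) (ae_of_all _ fun Y => sq_nonneg _)
    _ ≤ ∑ i, ∫⁻ Y, ENNReal.ofReal (‖fderiv ℝ Ψ.ψ (Matrix.vecCons x Y)
          (Pi.single 0 (EuclideanSpace.single i (1 : ℝ)))‖ ^ 2) :=
        Finset.sum_le_sum fun i _ => setLIntegral_le_lintegral _ _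
    _ = ∫⁻ Y, ∑ i, ENNReal.ofReal (‖fderiv ℝ Ψ.ψ (Matrix.vecCons x Y)
          (Pi.single 0 (EuclideanSpace.single i (1 : ℝ)))‖ ^ 2) :=
        (lintegral_finsetSum _ fun i _ => (hb i).measurable.ennreal_ofReal).symm
    _ = ∫⁻ Y, partialGradSq 0 Ψ.ψ (Matrix.vecCons x Y) := lintegral_congr fun Y => by
        unfold partialGradSq
        refine Finset.sum_congr rfl fun k _ => ?_
        rw [ENNReal.ofReal_pow (norm_nonneg _), ofReal_norm, enorm_eq_nnnorm]

/-- The regularised root `G_ε = √(P + ε)` of the marginal is `C¹` for `ε > 0`. [folklore] -/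
theorem contDiff_sqrt_marginal (Ψ : TrialState (n + 1) L) {ε : ℝ} (hε : 0 < ε) :
    ContDiff ℝ 1 fun x => Real.sqrt ((∫ Y : Config n, ‖Ψ.ψ (Matrix.vecCons x Y)‖ ^ 2) + ε) :=
  ((contDiff_marginal Ψ).add contDiff_const).sqrt fun x =>
    (add_pos_of_nonneg_of_pos (marginal_nonneg Ψ x) hε).ne'

/-- `Σ_i (∂_i √(P + ε))² ≤ Σ_i F_i` pointwise (`(∂_i P)² ≤ 4 P F_i` and `P/(P + ε) ≤ 1`).
[folklore] -/
theorem sum_sq_fderiv_sqrt_marginal_le (Ψ : TrialState (n + 1) L) {ε : ℝ} (hε : 0 < ε)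
    (x : Space) :
    ∑ i, (fderiv ℝ (fun y => Real.sqrt ((∫ Y : Config n, ‖Ψ.ψ (Matrix.vecCons y Y)‖ ^ 2) + ε))
        x (EuclideanSpace.single i 1)) ^ 2 ≤
      ∑ i, ∫ Y in {X : Config n | ∀ i j, X i j ∈ Icc (0 : ℝ) L},
        ‖fderiv ℝ Ψ.ψ (Matrix.vecCons x Y)
          (Pi.single 0 (EuclideanSpace.single i (1 : ℝ)))‖ ^ 2 := by
  set P : Space → ℝ := fun y => ∫ Y : Config n, ‖Ψ.ψ (Matrix.vecCons y Y)‖ ^ 2 with hPdef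
  have hP : 0 ≤ P x := marginal_nonneg Ψ x
  have hpos : 0 < P x + ε := add_pos_of_nonneg_of_pos hP hε
  have hd : HasFDerivAt (fun y => Real.sqrt (P y + ε)) ((1 / (2 * Real.sqrt (P x + ε))) •
      ∫ Y in {X : Config n | ∀ i j, X i j ∈ Icc (0 : ℝ) L},
        fderiv ℝ (fun y : Space => ‖Ψ.ψ (Matrix.vecCons y Y)‖ ^ 2) x) x :=
    ((hasFDerivAt_marginal Ψ x).add_const ε).sqrt hpos.ne'
  rw [hd.fderiv]
  refine Finset.sum_le_sum fun i _ => ?_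
  have hm := sq_marginalDeriv_le Ψ x i
  have hF : 0 ≤ ∫ Y in {X : Config n | ∀ i j, X i j ∈ Icc (0 : ℝ) L}, ‖fderiv ℝ Ψ.ψ
      (Matrix.vecCons x Y) (Pi.single 0 (EuclideanSpace.single i (1 : ℝ)))‖ ^ 2 :=
    setIntegral_nonneg (isCompact_closedBox n L).measurableSet fun _ _ => sq_nonneg _
  have hsq : Real.sqrt (P x + ε) ^ 2 = P x + ε := Real.sq_sqrt hpos.le
  show (1 / (2 * Real.sqrt (P x + ε)) * (∫ Y in {X : Config n | ∀ i j, X i j ∈ Icc (0 : ℝ) L},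
    fderiv ℝ (fun y : Space => ‖Ψ.ψ (Matrix.vecCons y Y)‖ ^ 2) x)
      (EuclideanSpace.single i 1)) ^ 2 ≤ _
  rw [mul_pow, div_pow, one_pow, mul_pow, hsq, one_div, inv_mul_le_iff₀ (by positivity)]
  nlinarith [hm, hF, hP, hε]

/-- **Fisher bound for the regularised root**: for `ε > 0` and every `x`,
`Σ_i (∂_i √(P + ε))²(x) ≤ ∫ |∇₀Ψ|²(x :: Y) dY` in `[0, ∞]` — the gradient input of the cube
log-Sobolev inequality applied to `√(P + ε)`. [folklore] -/
theorem fisher_bound (Ψ : TrialState (n + 1) L) {ε : ℝ} (hε : 0 < ε) (x : Space) :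
    ENNReal.ofReal (∑ i, (fderiv ℝ (fun y =>
        Real.sqrt ((∫ Y : Config n, ‖Ψ.ψ (Matrix.vecCons y Y)‖ ^ 2) + ε)) x
        (EuclideanSpace.single i 1)) ^ 2) ≤
      ∫⁻ Y, partialGradSq 0 Ψ.ψ (Matrix.vecCons x Y) :=
  (ENNReal.ofReal_le_ofReal (sum_sq_fderiv_sqrt_marginal_le Ψ hε x)).trans
    (ofReal_sum_fibreGradSq_le Ψ x)

end WithinCell

/-- **Registered helper stub `stub_withinCellFisherBound`** (= `WithinCell.fisher_bound`): for
every trial state, `ε > 0` and `x`, `Σ_i (∂_i √(P + ε))²(x) ≤ ∫ |∇₀Ψ|²(x :: Y) dY`. [folklore] -/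
theorem stub_withinCellFisherBound :
    ∀ (n : ℕ) (L : ℝ) (Ψ : Literature.MathematicalPhysics.QuantumManyBody.BoseGas.TrialState
      (n + 1) L) (ε : ℝ), 0 < ε → ∀ x : EuclideanSpace ℝ (Fin 3), ENNReal.ofReal (∑ i : Fin 3,
      (fderiv ℝ (fun y : EuclideanSpace ℝ (Fin 3) => Real.sqrt ((∫ Y :
      Literature.MathematicalPhysics.QuantumManyBody.BoseGas.Config n, ‖Ψ.ψ (Matrix.vecCons y
      Y)‖ ^ 2) + ε)) x (EuclideanSpace.single i 1)) ^ 2) ≤ ∫⁻ Y :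
      Literature.MathematicalPhysics.QuantumManyBody.BoseGas.Config n,
      Literature.MathematicalPhysics.QuantumManyBody.BoseGas.partialGradSq 0 Ψ.ψ (Matrix.vecCons
      x Y) :=
  fun _ _ Ψ _ hε x => WithinCell.fisher_bound Ψ hε x

end Summit.AtomisticToContinuum.BoseEinsteinCondensation.Cruxes.OneBodyEntropyBound.Birth

end
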